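import Summits.BirchSwinnertonDyer.Rank1Residual.X11b.BDPRouteCyclotomicCertificate
import Summits.BirchSwinnertonDyer.Rank1Residual.X11b.RegMultCertificateJoin
import HarnessLib

/-!
# Class X11b = N8 (census cell, seat `census-ctyper-2`, H-7 REG-MULT): ONE REGMULT row + the
# census column `p ∤ #Ш(E)_an` as the TWO per-pair inputs of multr1-p2's partner-free per-pair
# closure (p253610), SIGN-AWARE

HONEST FRAMING (verbatim, cell `b2b-bsdres`, run/shared/lean/b2b/bsd-rank1-residual/): the goal of
the cell is to DELETE the COMBINATION-SHAPED residual classes for ALL analytic-rank `≤ 1` curves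
over `ℚ` — 'full BSD formula for every rank `≤ 1` curve in class C' assembled STRICTLY from
published theorems — so that the rank-`≤ 1` remainder becomes exactly the CONSTRUCTION-SHAPED
classes, which are TYPED (missing-input Props), NOT attempted; this is not 'finishing BSD'.
Research routes; no claim beyond stated classes; census / instrument output = EVIDENCE /
certificate rows (instrumentation tier — what a certified row is worth is referee A's / the
director's ruling), never a Literature fact; nothing here books anything or changes a label or a
RESIDUAL-MAP mark; class X11b stays CONSTRUCTION-SHAPED; the class-wide statement behind a regulator
certificate is Schneider's conjecture (barrier `PAdicHeightNondegeneracy`), NEVER asserted here.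

## What this file adds (theorems only; 0 definitions, 0 named facts)

multr1-p2's `bsdp_of_classX11b_of_regulatorNonvanishing_of_padicValRat_shaAn_le` (p253610,
`BDPRouteCyclotomicCertificate`): on `ClassX11b W p`, `p ≥ 5`, `ρ̄_{E,p}` onto, `BSD(E,p)` follows
from the PUBLISHED named facts Kato–Wuthrich A32 (`hK`, integral Kato divisibility at a
multiplicative prime under surjectivity — NO (ram)), Stein–Wuthrich Thm. 6.1 / §4.2, Disegni 2020
Thm. 1 (`hD`, hypothesis (∗) at a split `p`: a second multiplicative prime), GZK, modularity, and TWO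
per-pair inputs: the bundled `ClassClosure.RegulatorNonvanishingAt W p` and `ord_p #Ш(E)_an ≤ 0`.
As recorded in `RegMultCongruenceTransport` (p254516), a REGMULT-PAIR/v1 row certifies ONE height —
`RegMult.CertSplit` on a split curve, `RegMult.CertNonsplit` on a non-split one — and on a split
curve the bundle's (4.1)-half is addressed by no certificate of record, while p253610 only USES the
half of the reduction sign (its own sign-specific theorems
`bsdp_of_katoSurj_{split,nonsplit}_of_schneider_of_padicValRat_shaAn_le` take exactly that half).
Hence the theorems below: p253610's conclusion from ONE REGMULT row of the sign's kind plus the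
`#Ш_an` valuation input. CENSUS POINTER (EVIDENCE, nothing booked): in the census join
`HOME/b2b-bsdres-census-ctyper2/regmult/INSTANCES-t0-C6.{md,tsv}` (REG-MULT tranche 0 = the 138
`¬Ram` N8 cells at `p ≥ 5`, 138/138 CERT, two engines, W5 kit j123725) the image is surjective on
137 cells, `p ∤ #Ш_an` (Cremona's VALUE, not yet a two-engine certificate) on 136, and Disegni's (∗)
holds on all split cells but one (`485100hk1@11`, single multiplicative prime); so 135 = 49
transport + 7 peu-ramifié + 79 très-ramifié cells have the SHAPE of `RegMult.bsdp_of_katoSurj_of_cert_of_padicValRat_shaAn_le`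
modulo the named facts and ONE further certificate (`ord_p #Ш_an ≤ 0`). Whether that closes anything is
referee A's ruling (tier), not this file's.

References: [Wuthrich2014] Thm. 3 (p. 383), Cor. 19 proof (p. 399); [SteinWuthrich2013] Thm. 6.1
(p. 20), §4.2 (pp. 15–16); [Disegni2020] Thm. 1 (§1.2), (∗); [Miller2011LMS] Def. 1.1, Prop. 7.6;
[KolyvaginEulerSystems1990] Thm. A (GZK); [Schneider1982] §1 (the conjecture behind the row).
-/

set_option autoImplicit false

noncomputable section

open scoped Classical MatrixGroups ModularForm

open CongruenceSubgroup WeierstrassCurve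
open Literature.NumberTheory.EllipticCurves
  Literature.NumberTheory.EllipticCurves.ModularForms
  Literature.NumberTheory.EllipticCurves.Rank1Residual
  Literature.NumberTheory.EllipticCurves.Rank1Residual.Typed
  Literature.NumberTheory.EllipticCurves.Wuthrich2014
  Literature.NumberTheory.EllipticCurves.SteinWuthrich2013
  Literature.NumberTheory.EllipticCurves.Disegni2020
  Literature.NumberTheory.EllipticCurves.Skinner2016

namespace Summit.BirchSwinnertonDyer.Rank1Residual.X11b

namespace RegMult

section Kato

variable (W : WeierstrassCurve ℚ) [W.IsElliptic] [W.IsGloballyMinimal] (p : ℕ) [Fact p.Prime]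

/-- **Per-pair closure, SPLIT cell, from ONE REGMULT row + `ord_p #Ш_an ≤ 0`:** `ClassX11b W p`,
`p ≥ 5`, `ρ̄_{E,p}` onto, `E` split at `p` with a second multiplicative prime (Disegni (∗), `hm`),
ONE row `RegMult.CertSplit W p P m` (`hc`: `m • P` admissible, modified §4.2 height of `m • P`
non-zero) and the valuation input `hv` for the (unique) rational value `s = #Ш(E)_an` ⇒ `BSD(E,p)`,
from Kato–Wuthrich A32 (`hK`), Stein–Wuthrich Thm. 6.1 split + modified height (`hJs hHs`),
Disegni Thm. 1 (`hD`), GZK, modularity — multr1-p2's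
`bsdp_of_katoSurj_split_of_schneider_of_padicValRat_shaAn_le` with `hSch` := the row
(`RegMult.schneiderHalf_split_of_cert`, Mordell–Weil rank one from GZK) and `ρ̄_{E,p^n}` onto for all
`n` from `ρ̄_{E,p}` onto at `p ≥ 5` (`surjective_pow_of_five_le`). NO partner, NO (ram), NO `μ`, NO
Heegner index. CONDITIONAL on the facts; both per-pair inputs are finite certificates (EVIDENCE,
instrumentation tier); nothing booked; X11b stays CONSTRUCTION-SHAPED.
[cite: Wuthrich2014, Thm. 3 (p. 383)] [cite: SteinWuthrich2013, Thm. 6.1 (p. 20), §4.2 (p. 16)]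
[cite: Disegni2020, Thm. 1 (§1.2), hypothesis (∗)] [cite: Miller2011LMS, Def. 1.1, Prop. 7.6] -/
theorem bsdp_of_katoSurj_of_certSplit_of_padicValRat_shaAn_le
    (hK : kato_charIdeal_dvd_multiplicative_of_surjective) (hJs : thm61_splitMultiplicative)
    (hHs : exists_isSplitMultCanonical) (hD : thm1_padicBSD_rankOne_multiplicative)
    (hGZK : rank_eq_analyticRank_of_analyticRank_le_one) (hpar : nonempty_modularParametrizationData)
    (hp5 : 5 ≤ p) (hX : ClassX11b W p) (hsurj : Surj W p)
    (hsplit : W.HasSplitMultiplicativeReductionAtPrime p)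
    (hm : ∃ (m : ℕ) (_ : Fact m.Prime), m ≠ p ∧ W.HasMultiplicativeReductionAtPrime m)
    {P : W.toAffine.Point} {m : ℕ} (hc : CertSplit W p P m)
    {s : ℚ} (hs : shaAn W = (s : ℂ)) (hv : padicValRat p s ≤ 0) : BSDp W p :=
  bsdp_of_katoSurj_split_of_schneider_of_padicValRat_shaAn_le W p hK hJs hHs hD hGZK hpar hp5 hX.2.2.1
    hsplit hX.1 (kato_charIdeal_dvd_multiplicative_of_surjective.surjective_pow_of_five_le W p hp5 hsurj)
    hm (schneiderHalf_split_of_cert (mordellWeilRank_eq_one_of_analyticRank hGZK hX.1) hc) hs hv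

/-- **Per-pair closure, NON-SPLIT cell, from ONE REGMULT row + `ord_p #Ш_an ≤ 0`:** as
`bsdp_of_katoSurj_of_certSplit_of_padicValRat_shaAn_le` with ONE row `RegMult.CertNonsplit W p P m`
(the Stein–Wuthrich (4.1) height of `m • P` non-zero for THE Tate parameter) and no (∗).
CONDITIONAL; nothing booked. [cite: Wuthrich2014, Thm. 3 (p. 383)]
[cite: SteinWuthrich2013, Thm. 6.1 (p. 20), §4.2 (p. 15)] [cite: Disegni2020, Thm. 1 (§1.2)]
[cite: Miller2011LMS, Def. 1.1, Prop. 7.6] -/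
theorem bsdp_of_katoSurj_of_certNonsplit_of_padicValRat_shaAn_le
    (hK : kato_charIdeal_dvd_multiplicative_of_surjective) (hJn : thm61_nonsplitMultiplicative)
    (hHn : exists_isMultCanonical) (hD : thm1_padicBSD_rankOne_multiplicative)
    (hGZK : rank_eq_analyticRank_of_analyticRank_le_one) (hpar : nonempty_modularParametrizationData)
    (hp5 : 5 ≤ p) (hX : ClassX11b W p) (hsurj : Surj W p)
    (hns : ¬ W.HasSplitMultiplicativeReductionAtPrime p)
    {P : W.toAffine.Point} {m : ℕ} (hc : CertNonsplit W p P m)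
    {s : ℚ} (hs : shaAn W = (s : ℂ)) (hv : padicValRat p s ≤ 0) : BSDp W p :=
  bsdp_of_katoSurj_nonsplit_of_schneider_of_padicValRat_shaAn_le W p hK hJn hHn hD hGZK hpar (by omega)
    hX.2.2.1 hns hX.1
    (kato_charIdeal_dvd_multiplicative_of_surjective.surjective_pow_of_five_le W p hp5 hsurj)
    (schneiderHalf_nonsplit_of_cert (mordellWeilRank_eq_one_of_analyticRank hGZK hX.1) hc) hs hv

/-- **Per-pair closure from ONE REGMULT row of the reduction sign's kind + `ord_p #Ш_an ≤ 0`,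
either sign** (`hcs` used iff split — then (∗) `hstar` is due —, `hcn` iff non-split): the shape
of 135 of the 138 `¬Ram` N8 cells of the census tranche 0 (the exceptions: `84960d1@5` image `5Ns`,
`485100hk1@11` split with a single multiplicative prime, one cell with `5 ∣ #Ш_an`), modulo the named
facts and the `#Ш_an` certificate. CONDITIONAL; per pair; nothing booked.
[cite: Wuthrich2014, Thm. 3 (p. 383), Cor. 19 proof (p. 399)] [cite: SteinWuthrich2013, Thm. 6.1, §4.2]
[cite: Disegni2020, Thm. 1 (§1.2), (∗)] [cite: Miller2011LMS, Def. 1.1, Prop. 7.6] -/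
theorem bsdp_of_katoSurj_of_cert_of_padicValRat_shaAn_le
    (hK : kato_charIdeal_dvd_multiplicative_of_surjective)
    (hJn : thm61_nonsplitMultiplicative) (hJs : thm61_splitMultiplicative)
    (hHn : exists_isMultCanonical) (hHs : exists_isSplitMultCanonical)
    (hD : thm1_padicBSD_rankOne_multiplicative)
    (hGZK : rank_eq_analyticRank_of_analyticRank_le_one) (hpar : nonempty_modularParametrizationData)
    (hp5 : 5 ≤ p) (hX : ClassX11b W p) (hsurj : Surj W p)
    (hstar : W.HasSplitMultiplicativeReductionAtPrime p →
      ∃ (m : ℕ) (_ : Fact m.Prime), m ≠ p ∧ W.HasMultiplicativeReductionAtPrime m)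
    {P : W.toAffine.Point} {m : ℕ}
    (hcn : ¬ W.HasSplitMultiplicativeReductionAtPrime p → CertNonsplit W p P m)
    (hcs : W.HasSplitMultiplicativeReductionAtPrime p → CertSplit W p P m)
    {s : ℚ} (hs : shaAn W = (s : ℂ)) (hv : padicValRat p s ≤ 0) : BSDp W p := by
  by_cases hsplit : W.HasSplitMultiplicativeReductionAtPrime p
  · exact bsdp_of_katoSurj_of_certSplit_of_padicValRat_shaAn_le W p hK hJs hHs hD hGZK hpar hp5 hX hsurj
      hsplit (hstar hsplit) (hcs hsplit) hs hv
  · exact bsdp_of_katoSurj_of_certNonsplit_of_padicValRat_shaAn_le W p hK hJn hHn hD hGZK hpar hp5 hX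
      hsurj hsplit (hcn hsplit) hs hv

omit [Fact p.Prime] in
/-- **The `#Ш_an` input in the census column's currency**: if `#Ш(E)_an` is (the cast of) a natural
number `n` with `p ∤ n`, then `padicValRat p n ≤ 0` — so a certified INTEGER value of `#Ш_an` prime
to `p` discharges `hv` (with `s := n`). [folklore] -/
theorem padicValRat_natCast_le_zero_of_not_dvd {n : ℕ} (hn : ¬ p ∣ n) :
    padicValRat p (n : ℚ) ≤ 0 := by
  rw [padicValRat.of_nat, padicValNat.eq_zero_of_not_dvd hn]
  simp

end Kato

end RegMult

end Summit.BirchSwinnertonDyer.Rank1Residual.X11b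

end
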